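import Summits.HodgeConjecture.HodgeConjecture.Theorems.K2E3WittLeviCartanLabels
import HarnessLib

/-!
# Levi Cartan decomposition of `U(σ, J₀)`, II: the recursion over the first `GL` block (crux H413, U12-g ∕ 13a road A, item (B) `hcartanLevi`)

Cell `hodgecm-mathlib`, Track B, line `K2_E3_EllipticInputs`, 13a road A; seat K2E3-p10 (g3).  THEOREMS ONLY; count-neutral helper.

For the quasi-split Witt form `W = J₀` in a STANDARD indexing `e : WittIndex r m ≃ Fin N` (`m ≤ 1`) and `S ⊆ Fin r` (the simple roots of the Levi `M_S`), every
`g ∈ U(σ, J₀)(K)` which is block diagonal for the labelling `wittBlockOn e S` is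

  `g = k₁ · diag(ϖ^E) · k₂`,  `k₁, k₂ ∈ U ∩ GL_N(𝒪) ∩ M_S`,  `E : Fin N → ℤ` ANTITONE ON EACH `S`-BLOCK with `E ∘ rev = −E`

(`exists_leviIntegral_mul_zpowDiagGL_mul`, under ★ `UnramifiedLocalConjDatum σ ϖ` and a principal valuation ring).  Proof: strong induction on the Witt index `r`.
`S = univ` is the Cartan decomposition of `U` itself (★ `heckeCosetMk_zpowDiagGL_eq_of_unitary`).  Otherwise let `α₀` be the least break (`α₀ ∉ S`) and
`c = α₀ + 1`: `M_S` lies in the Levi `GL_c × U(J₀^{(N−2c)})` of the maximal parabolic `Q_c` (★ `HermitianLattice.blockParabolic`; §1 compares the labellings),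
the first block `loBlockGL g ∈ GL_c(K)` has a sorted Cartan decomposition (★ `K2E3WittLeviCartanBlocks.exists_integral_mul_zpowDiagGL_antitone_mul`), the middle
block `midBlockU g ∈ U(J₀^{(N−2c)})` is block diagonal for the SHIFTED datum `(e′, S′)` (§1 `wittBlockNat_symm_midIndex`) and decomposes by induction, and the
three pieces are glued by ★ `blockDiagLift` and the rigidity ★ `eq_of_loBlockGL_eq_of_midBlockU_eq`.

The sequel `K2E3WittLeviCartanUnramified` rewrites `diag(ϖ^E)` as `∏_{β ∈ S} a_β(ϖ)^{n β} · z` with `z ∈ Z(M_S)` — the frozen `hcartanLevi(S)` shape of ★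
`K2E3WittLeviCuspidalDichotomyOfCartan`.

References: F. Bruhat, J. Tits (1972), (4.4.3); J. Tits (1979), §3.3.3; I. N. Bernstein, A. V. Zelevinsky (1977), §2.1; I. G. Macdonald (1995), Ch. V §2.
-/

set_option autoImplicit false
set_option linter.dupNamespace false

noncomputable section

open scoped Valued WithZero Matrix MatrixGroups
open Matrix

namespace Summit.HodgeConjecture.HodgeConjecture.Cruxes.H413.K2E3WittLeviCartanRecursion

open Literature.NumberTheory.Automorphic Literature.NumberTheory.Automorphic.HermitianLattice
open Literature.NumberTheory.Automorphic.CartanUnique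
open K2E3LocalUnitaryWitt K2E3WittLeviCartanBlocks K2E3WittCartanUnramified K2E3WittLeviCartanLabels

/-! ## §2 The recursion -/

section Recursion

variable {K : Type*} [Field K] [Valued K ℤᵐ⁰] [IsPrincipalIdealRing (Valued.v (R := K)).valuationSubring] {σ : K →+* K} {ϖ : K}

/-- **LEVI CARTAN DECOMPOSITION, diagonal form**: for `W = J₀` in a standard indexing `e : WittIndex r m ≃ Fin N` (`m ≤ 1`) and every `S ⊆ Fin r`, every
`g ∈ U(σ, J₀) ∩ M_S` (block diagonal for `wittBlockOn e S`) is `k₁ · diag(ϖ^E) · k₂` with `k₁, k₂ ∈ U ∩ GL_N(𝒪) ∩ M_S` and `E : Fin N → ℤ` antitone on each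
`S`-block, `E ∘ rev = −E` (★ `UnramifiedLocalConjDatum σ ϖ`; principal valuation ring).  Strong induction on `r`, peeling the first `GL` block.
[cite: BruhatTits1972, (4.4.3)] [cite: Tits1979, §3.3.3] [cite: Macdonald1995, Ch. V §2 (2.2)] -/
theorem exists_leviIntegral_mul_zpowDiagGL_mul (hd : UnramifiedLocalConjDatum σ ϖ) :
    ∀ (r : ℕ) {m N : ℕ} (_hm : m ≤ 1) (e : WittIndex r m ≃ Fin N)
      (_hstd : ∀ x, (e x).val = Sum.elim (fun i : Fin r => i.val) (Sum.elim (fun u : Fin m => r + u.val) (fun j : Fin r => r + m + j.val)) x)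
      (S : Finset (Fin r)) (g : unitaryGroupOfForm σ ((StdForm.antidiagonal N).over K))
      (_hgL : (g : GL (Fin N) K) ∈ standardLeviGL K (wittBlockOn e S)),
      ∃ k₁ k₂ : unitaryGroupOfForm σ ((StdForm.antidiagonal N).over K),
        k₁ ∈ unitaryInt σ ((StdForm.antidiagonal N).over K) ∧ (k₁ : GL (Fin N) K) ∈ standardLeviGL K (wittBlockOn e S) ∧
        k₂ ∈ unitaryInt σ ((StdForm.antidiagonal N).over K) ∧ (k₂ : GL (Fin N) K) ∈ standardLeviGL K (wittBlockOn e S) ∧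
        ∃ E : Fin N → ℤ, (∀ i j : Fin N, wittBlockOn e S i = wittBlockOn e S j → i ≤ j → E j ≤ E i) ∧ (∀ i, E (Fin.rev i) = -E i) ∧
          (g : GL (Fin N) K) = k₁ * zpowDiagGL hd.ϖ_ne_zero E * k₂ := by
  intro r
  induction r using Nat.strong_induction_on with
  | _ r IH =>
  intro m N hm e hstd S g hgL
  have hN : N = r + (m + r) := by simpa using (Fintype.card_congr e).symm
  by_cases hS : Finset.univ \ S = ∅
  · -- `S = univ`: the Cartan decomposition of `U` itself
    have hSu : S = Finset.univ := Finset.univ_subset_iff.1 (Finset.sdiff_eq_empty_iff_subset.1 hS)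
    subst hSu
    have hlab : ∀ i j : Fin N, wittBlockOn e (Finset.univ : Finset (Fin r)) i = wittBlockOn e Finset.univ j := fun i j => by
      rw [wittBlockOn_apply, wittBlockOn_apply, wittBlock_univ, wittBlock_univ]
    obtain ⟨a, ⟨hanti, hrev⟩, hcoset⟩ := heckeCosetMk_zpowDiagGL_eq_of_unitary hd g
    obtain ⟨k₁, hk₁, k₂, hk₂, hgk⟩ := (heckeAlgebra.heckeCosetMk_eq_iff _ _ _).1 hcoset
    refine ⟨k₁, k₂, hk₁, (mem_standardLeviGL_iff _ _).2 fun i j hij => absurd (hlab i j) hij, hk₂,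
      (mem_standardLeviGL_iff _ _).2 fun i j hij => absurd (hlab i j) hij, a, fun i j _ hij => hanti hij, hrev, ?_⟩
    have h := congrArg (fun x : unitaryGroupOfForm σ ((StdForm.antidiagonal N).over K) => (x : GL (Fin N) K)) hgk
    simpa only [Subgroup.coe_mul] using h
  · -- the first break `α₀`, `c = α₀ + 1`
    have hne : (Finset.univ \ S).Nonempty := Finset.nonempty_iff_ne_empty.2 hS
    obtain ⟨α₀, hα₀mem, hα₀min⟩ : ∃ α₀ ∈ Finset.univ \ S, ∀ α ∈ Finset.univ \ S, α₀ ≤ α :=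
      ⟨(Finset.univ \ S).min' hne, Finset.min'_mem _ hne, fun α hα => Finset.min'_le _ _ hα⟩
    have hα₀ : α₀ ∉ S := (Finset.mem_sdiff.1 hα₀mem).2
    have hmin : ∀ α, α ∉ S → α₀ ≤ α := fun α hα => hα₀min α (Finset.mem_sdiff.2 ⟨Finset.mem_univ _, hα⟩)
    have hα₀r := α₀.isLt
    have hc : 2 * (α₀.val + 1) ≤ N := by omega
    have hN' : (r - (α₀.val + 1)) + (m + (r - (α₀.val + 1))) = N - 2 * (α₀.val + 1) := by omega
    have hr' : r - (α₀.val + 1) < r := by omega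
    -- `g ∈ Q_c`, block diagonal
    have hgP : g ∈ blockParabolic σ N (α₀.val + 1) := mem_blockParabolic_of_mem_standardLeviGL e hstd hm hα₀ hmin hgL
    have hgP' := mem_standardParabolicGL_toDual_of_mem_standardLeviGL e hstd hm hα₀ hmin hgL
    -- the first block
    obtain ⟨κ₁, κ₂, hκ₁, hκ₂, lam, hlam, hA⟩ := exists_integral_mul_zpowDiagGL_antitone_mul hd.vϖ (loBlockGL hc ⟨g, hgP⟩)
    -- the middle block, by induction on the shifted datum
    have hg'L := coe_midBlockU_mem_standardLeviGL e hstd hα₀ hmin hc hN' hgL hgP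
    obtain ⟨κ₁', κ₂', hκ₁', hκ₁'L, hκ₂', hκ₂'L, E', hE'anti, hE'rev, hg'⟩ :=
      IH _ hr' hm (stdWittEquivFin (r - (α₀.val + 1)) m hN') (stdWittEquivFin_hstd (r - (α₀.val + 1)) m hN')
        (Finset.univ.filter fun α' : Fin (r - (α₀.val + 1)) => (⟨α'.val + (α₀.val + 1), by have := α'.isLt; omega⟩ : Fin r) ∈ S)
        (midBlockU hc ⟨g, hgP⟩) hg'L
    -- the glued exponent function
    obtain ⟨E, hE⟩ : ∃ E : Fin N → ℤ, E = fun p => if h0 : p.val < α₀.val + 1 then lam ⟨p.val, h0⟩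
        else if h1 : p.val + (α₀.val + 1) < N then E' ⟨p.val - (α₀.val + 1), by omega⟩ else -lam ⟨N - 1 - p.val, by omega⟩ := ⟨_, rfl⟩
    have hElo : ∀ i : Fin (α₀.val + 1), E (Fin.castLE (le_of_two_mul_le hc) i) = lam i := fun i => by
      rw [hE]; dsimp only; rw [dif_pos (by exact i.isLt)]
      exact congrArg lam (Fin.ext rfl)
    have hEmid : ∀ j : Fin (N - 2 * (α₀.val + 1)), E (midIndex hc j) = E' j := fun j => by
      have hj := j.isLt
      have h1 : ¬ ((midIndex hc j).val < α₀.val + 1) := by rw [coe_midIndex]; omega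
      have h2 : (midIndex hc j).val + (α₀.val + 1) < N := by rw [coe_midIndex]; omega
      rw [hE]; dsimp only; rw [dif_neg h1, dif_pos h2]
      congr 1; apply Fin.ext; change (midIndex hc j).val - (α₀.val + 1) = j.val; rw [coe_midIndex]; omega
    have hEhi : ∀ i : Fin (α₀.val + 1), E (hiIndex hc i) = -lam (Fin.rev i) := fun i => by
      have hi := i.isLt
      have h1 : ¬ ((hiIndex hc i).val < α₀.val + 1) := by rw [coe_hiIndex]; omega
      have h2 : ¬ ((hiIndex hc i).val + (α₀.val + 1) < N) := by rw [coe_hiIndex]; omega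
      rw [hE]; dsimp only; rw [dif_neg h1, dif_neg h2]
      congr 2; apply Fin.ext; change N - 1 - (hiIndex hc i).val = (Fin.rev i).val; rw [Fin.val_rev, coe_hiIndex]; omega
    have hErev : ∀ p, E (Fin.rev p) = -E p := by
      intro p
      obtain ⟨x, rfl⟩ := (blockSum hc).surjective p
      rcases x with (i | i) | i
      · rw [blockSum_inl_inl, rev_castLE hc, hEhi, Fin.rev_rev, hElo]
      · rw [blockSum_inl_inr, rev_midIndex hc, hEmid, hEmid, hE'rev]
      · rw [blockSum_inr, rev_hiIndex hc, hElo, hEhi, neg_neg]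
    have hEanti : ∀ i j : Fin N, wittBlockOn e S i = wittBlockOn e S j → i ≤ j → E j ≤ E i := by
      intro p q hlab hpq
      have hb := blockLabel_eq_of_wittBlockOn_eq e hstd hm hα₀ hmin hlab
      obtain ⟨x, rfl⟩ := (blockSum hc).surjective p
      obtain ⟨y, rfl⟩ := (blockSum hc).surjective q
      rcases x with (i | i) | i <;> rcases y with (j | j) | j <;>
        simp only [blockSum_inl_inl, blockSum_inl_inr, blockSum_inr, blockLabel_castLE hc, blockLabel_midIndex hc, blockLabel_hiIndex hc] at hb
      all_goals first
        | exact absurd hb (by decide)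
        | skip
      · rw [blockSum_inl_inl] at hpq ⊢; rw [blockSum_inl_inl] at hpq ⊢
        rw [hElo, hElo]
        exact hlam ((Fin.castLE_le_castLE_iff _).1 hpq)
      · rw [blockSum_inl_inr] at hlab hpq ⊢; rw [blockSum_inl_inr] at hlab hpq ⊢
        rw [hEmid, hEmid]
        refine hE'anti i j (Fin.ext ?_) (Fin.le_iff_val_le_val.2 ?_)
        · have h' := congrArg Fin.val hlab
          rw [wittBlockOn_apply, wittBlockOn_apply, wittBlock_val, wittBlock_val, wittBlockNat_symm_midIndex e hstd hα₀ hmin hc hN',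
            wittBlockNat_symm_midIndex e hstd hα₀ hmin hc hN'] at h'
          rw [wittBlockOn_apply, wittBlockOn_apply, wittBlock_val, wittBlock_val]
          omega
        · rw [Fin.le_iff_val_le_val, coe_midIndex, coe_midIndex] at hpq; omega
      · rw [blockSum_inr] at hpq ⊢; rw [blockSum_inr] at hpq ⊢
        rw [hEhi, hEhi, neg_le_neg_iff]
        refine hlam (Fin.rev_le_rev.2 (Fin.le_iff_val_le_val.2 ?_))
        rw [Fin.le_iff_val_le_val, coe_hiIndex, coe_hiIndex] at hpq; omega
    -- the three factors `k₁ = diag(κ₁, κ₁′, κ₁†)`, `D = diag(ϖ^E)`, `k₂ = diag(κ₂, κ₂′, κ₂†)`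
    have hk₁P : blockDiagLift hd.σσ hc κ₁ κ₁' ∈ blockParabolic σ N (α₀.val + 1) := blockDiagLift_mem_blockParabolic hd.σσ hc κ₁ κ₁'
    have hk₂P : blockDiagLift hd.σσ hc κ₂ κ₂' ∈ blockParabolic σ N (α₀.val + 1) := blockDiagLift_mem_blockParabolic hd.σσ hc κ₂ κ₂'
    have hDP : (⟨zpowDiagGL hd.ϖ_ne_zero E, zpowDiagGL_mem_unitaryGroupOfForm hd.σϖ _ hErev⟩ :
        unitaryGroupOfForm σ ((StdForm.antidiagonal N).over K)) ∈ blockParabolic σ N (α₀.val + 1) :=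
      zpowDiagGL_mem_blockParabolic hd.σϖ hd.ϖ_ne_zero hc hErev
    -- the product `k₁ D k₂` inside `Q_c`
    have hprodP' : ((((⟨blockDiagLift hd.σσ hc κ₁ κ₁', hk₁P⟩ : blockParabolic σ N (α₀.val + 1)) *
        ⟨⟨zpowDiagGL hd.ϖ_ne_zero E, zpowDiagGL_mem_unitaryGroupOfForm hd.σϖ _ hErev⟩, hDP⟩ * ⟨blockDiagLift hd.σσ hc κ₂ κ₂', hk₂P⟩ :
          blockParabolic σ N (α₀.val + 1)) : unitaryGroupOfForm σ ((StdForm.antidiagonal N).over K)) : GL (Fin N) K) ∈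
        standardParabolicGL K (OrderDual.toDual ∘ blockLabel N (α₀.val + 1)) := by
      rw [Subgroup.coe_mul, Subgroup.coe_mul, Subgroup.coe_mul, Subgroup.coe_mul]
      exact Subgroup.mul_mem _ (Subgroup.mul_mem _ (coe_blockDiagLift_mem_standardParabolicGL_toDual hd.σσ hc κ₁ κ₁')
        (zpowDiagGL_mem_standardParabolicGL _ hd.ϖ_ne_zero E)) (coe_blockDiagLift_mem_standardParabolicGL_toDual hd.σσ hc κ₂ κ₂')
    have hlamE : zpowDiagGL (uniformizer_ne_zero hd.vϖ) lam = zpowDiagGL hd.ϖ_ne_zero (E ∘ Fin.castLE (le_of_two_mul_le hc)) := by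
      rw [show lam = E ∘ Fin.castLE (le_of_two_mul_le hc) from (funext hElo).symm]
    -- the equation, by rigidity
    have heq : g = (((⟨blockDiagLift hd.σσ hc κ₁ κ₁', hk₁P⟩ : blockParabolic σ N (α₀.val + 1)) *
        ⟨⟨zpowDiagGL hd.ϖ_ne_zero E, zpowDiagGL_mem_unitaryGroupOfForm hd.σϖ _ hErev⟩, hDP⟩ * ⟨blockDiagLift hd.σσ hc κ₂ κ₂', hk₂P⟩ :
          blockParabolic σ N (α₀.val + 1)) : unitaryGroupOfForm σ ((StdForm.antidiagonal N).over K)) := by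
      refine eq_of_loBlockGL_eq_of_midBlockU_eq hc hgP hgP' (Subtype.prop _) hprodP' ?_ ?_
      · change loBlockGL hc ⟨g, hgP⟩ = loBlockGL hc ((⟨blockDiagLift hd.σσ hc κ₁ κ₁', hk₁P⟩ : blockParabolic σ N (α₀.val + 1)) *
          ⟨⟨zpowDiagGL hd.ϖ_ne_zero E, zpowDiagGL_mem_unitaryGroupOfForm hd.σϖ _ hErev⟩, hDP⟩ * ⟨blockDiagLift hd.σσ hc κ₂ κ₂', hk₂P⟩)
        rw [map_mul, map_mul, loBlockGL_blockDiagLift, loBlockGL_blockDiagLift, loBlockGL_zpowDiagGL hd.σϖ hd.ϖ_ne_zero hc hErev, hA, hlamE]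
      · change midBlockU hc ⟨g, hgP⟩ = midBlockU hc ((⟨blockDiagLift hd.σσ hc κ₁ κ₁', hk₁P⟩ : blockParabolic σ N (α₀.val + 1)) *
          ⟨⟨zpowDiagGL hd.ϖ_ne_zero E, zpowDiagGL_mem_unitaryGroupOfForm hd.σϖ _ hErev⟩, hDP⟩ * ⟨blockDiagLift hd.σσ hc κ₂ κ₂', hk₂P⟩)
        rw [map_mul, map_mul, midBlockU_blockDiagLift, midBlockU_blockDiagLift]
        refine Subtype.ext ?_
        rw [hg', Subgroup.coe_mul, Subgroup.coe_mul]
        congr 2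
        refine Units.ext ?_
        rw [coe_zpowDiagGL, coe_midBlockU_zpowDiagGL hd.σϖ hd.ϖ_ne_zero hc hErev]
        congr 1
        funext j
        rw [hEmid]
    refine ⟨_, _, blockDiagLift_mem_unitaryInt hd.σσ hd.vσ hc hκ₁.1 hκ₁.2.1 hκ₁',
      coe_blockDiagLift_mem_standardLeviGL e hstd hm hα₀ hmin hd.σσ hc hN' κ₁ hκ₁'L,
      blockDiagLift_mem_unitaryInt hd.σσ hd.vσ hc hκ₂.1 hκ₂.2.1 hκ₂',
      coe_blockDiagLift_mem_standardLeviGL e hstd hm hα₀ hmin hd.σσ hc hN' κ₂ hκ₂'L, E, hEanti, hErev, ?_⟩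
    have h := congrArg (fun x : unitaryGroupOfForm σ ((StdForm.antidiagonal N).over K) => (x : GL (Fin N) K)) heq
    simp only [Subgroup.coe_mul] at h
    exact h

end Recursion

end Summit.HodgeConjecture.HodgeConjecture.Cruxes.H413.K2E3WittLeviCartanRecursion

end
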